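import Summits.HubbardSuperconductivity.HubbardSuperconductivity.Theorems.FunctionFieldCertificateNecessaryPoleOrderBoostedPairField
import Mathlib.Analysis.SpecialFunctions.Trigonometric.Bounds
import HarnessLib

/-!
# Route `FunctionFieldCertificate` — support item `NecessaryPoleOrder`
# (stmt-HubbardSuperconductivity-7792): the necessary-pole lemma in TWIST FORM, proved

The item is filed informally ("some KKT/R multiplier of every valid function-field certificate of
`d`-wave pair order `a > 0` must be infrared-singular"); its proof sketch is the Lieb–Schultz–Mattis
twist. This file proves the statement the sketch actually establishes, in the vocabulary of the
landed definition `SymbolCertificate` (the typing proposed to the planner as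
`NecessaryPoleOrderTwistForm`, stated here VERBATIM as `necessaryPoleOrder_twistForm`): for every
`c : SymbolCertificate U δ deg p a`, `a > 0`, `δ ∈ (0, 1/2)` (any `U`, degree, declared pole order)
there is `L₁` such that on every even torus of side `L ≥ L₁`, in EVERY normalised
`(N_L, S^z = 0)`-sector ground state `ψ`, some boost `W_j = orbitalPhase ((x,σ) ↦ e^{2πi j x₁/L})`,
`1 ≤ j ≤ ⌊256/a⌋ + 1`, has a TWIST DEFECT (KKT channel conjugated by `W_j` against the twist cost
`D_j = W_j H_L W_jᴴ - H_L`, plus the `R`-channel defect) of absolute value `> a/4`.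

Ingredients proved here, specialising `FunctionFieldCertificateNecessaryPoleOrderBoostedPairField.lean`
to the windings `k_j = (j, 0)`:
* `ffc_norm_lsmChar_sub_one_le` — `‖χ_{k_j}(e) - 1‖ ≤ 2π j / L` on the steps, so the boost
  constant is `≤ (2 Σ_e |g e/√2|) · 2πj/L` (`ffc_lsmBoostConstant_le`), `(2·4/√2)² = 32` for `d`-wave;
* `ffc_sum_pairStructureFactor_le` — the pair sum rule as a pigeonhole, `Σ_{m ∈ S} S_ψ(m) ≤ 32 L² ‖ψ‖²`;
* `ffc_sum_lsmBoosted_pairOrder_le` — `Σ_{j ∈ T} L⁻⁴ ‖Δ_d W_jᴴ ψ‖² ≤ (64 + 256 π² (Σ_T j²)/L²) ‖ψ‖²`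
  for windings with `2j < L` (the momenta `2k_j` are distinct).
Assembly (`necessaryPoleOrder_twistForm`): if all defects were `≤ a/4`, the twisted evaluation
`hubbardSymbolCertificate_twisted_order_expectation_ge` (with `V = W_jᴴ`) gives
`L⁻⁴ ‖Δ_d W_jᴴ ψ‖² ≥ a - C/L - a/4 ≥ 5a/8` for `j ≤ J₀ = ⌊256/a⌋ + 1` once `L ≥ 8|C|/a`, while the
sum over `j ≤ J₀` is `≤ 64 + 256π² J₀³/L² ≤ 65` for `L ≥ 16π J₀²`; but `J₀ · 5a/8 > 160`. (Not
vacuous: normalised sector ground states exist, e.g. `DeformationLadder.penalisedGroundStateExists_proof`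
with penalty `0`.) Consequence for the route: a certificate whose evaluated KKT/`R` channels all
have `o(1)` twist defects under the `U_j` — in particular Riemann-normalised families with POLE-FREE
weights (defect `O(j/L)`) — cannot exist. No definition is introduced.

References: E. H. Lieb, T. Schultz, D. Mattis, Ann. Phys. 16 (1961) 407, App. B; T. Kennedy,
E. H. Lieb, B. S. Shastry, PRL 61 (1988) 2582 (sum rule); T. Koma, H. Tasaki, J. Stat. Phys. 76
(1994) 745; route thesis `Theses/FunctionFieldCertificate.lean` (item 7792, card
`function-field-kkt-certificates` K2).
-/

namespace Summit.HubbardSuperconductivity.HubbardSuperconductivity.Theorems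

-- the problem namespace `HubbardSuperconductivity.HubbardSuperconductivity` is the tree's layout (D-0017)
set_option linter.dupNamespace false

open Matrix Finset Literature.MathematicalPhysics.QuantumLattice Literature.Probability.LatticeModels
  Literature.Barriers.HubbardSuperconductivity
open scoped Matrix.Norms.L2Operator ComplexOrder ComplexConjugate

section LsmBoosts

variable (L : ℕ) [NeZero L]


/-- The character of the boost `k = (j, 0)` on a step `e ∈ {0, ±e₁, ±e₂}` is `e^{2πi j e₀ / L}`.
[folklore] -/
theorem ffc_lsmChar_proj (j : ℕ) (e : Site 2) :
    torusChar (Pi.single 0 (j : ZMod L) : TorusSite 2 L) (Torus.proj L e) =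
      Complex.exp (2 * Real.pi * Complex.I * ((j * e 0 : ℤ) : ℂ) / L) := by
  rw [← ZMod.stdAddChar_coe, torusChar, Fin.prod_univ_two]
  simp [Torus.proj_apply]

/-- For the boost `k = (j, 0)`: `‖χ_k(e) - 1‖ ≤ 2π j / L` on every step `e ∈ {0, ±e₁, ±e₂}`
(`|e₀| ≤ 1`, `‖e^{iα} - 1‖ ≤ |α|`). [folklore] -/
theorem ffc_norm_lsmChar_sub_one_le (j : ℕ) {e : Site 2} (he : e ∈ insert (0 : Site 2) unitSteps) :
    ‖torusChar (Pi.single 0 (j : ZMod L) : TorusSite 2 L) (Torus.proj L e) - 1‖ ≤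
      2 * Real.pi * j / L := by
  rw [ffc_lsmChar_proj]
  have h1 : Complex.exp (2 * Real.pi * Complex.I * ((j * e 0 : ℤ) : ℂ) / L) =
      Complex.exp (Complex.I * ((2 * Real.pi * (j * e 0 : ℤ) / L : ℝ) : ℂ)) := by
    congr 1
    push_cast
    ring
  rw [h1]
  refine Real.norm_exp_I_mul_ofReal_sub_one_le.trans ?_
  have hL : (0 : ℝ) < L := Nat.cast_pos.2 (Nat.pos_of_ne_zero (NeZero.ne L))
  have he0 : |((j * e 0 : ℤ) : ℝ)| ≤ j := by
    rcases apply_mem_insert_unitSteps he 0 with h | h | h <;> simp [h]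
  rw [Real.norm_eq_abs, abs_div, abs_of_pos hL, div_le_div_iff_of_pos_right hL, abs_mul,
    abs_of_pos Real.two_pi_pos]
  exact mul_le_mul_of_nonneg_left he0 Real.two_pi_pos.le

/-- The boost constant of `k = (j, 0)`: `2 Σ_e |g e/√2| ‖χ_k(e) - 1‖ ≤ (2 Σ_e |g e/√2|) · 2π j / L`.
[folklore] -/
theorem ffc_lsmBoostConstant_le (g : Site 2 → ℝ) (j : ℕ) :
    2 * ∑ e ∈ insert (0 : Site 2) unitSteps,
        |g e / Real.sqrt 2| * ‖torusChar (Pi.single 0 (j : ZMod L) : TorusSite 2 L) (Torus.proj L e) - 1‖ ≤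
      (2 * ∑ e ∈ insert (0 : Site 2) unitSteps, |g e / Real.sqrt 2|) * (2 * Real.pi * j / L) := by
  rw [mul_assoc, Finset.sum_mul]
  refine mul_le_mul_of_nonneg_left (Finset.sum_le_sum fun e he => ?_) zero_le_two
  exact mul_le_mul_of_nonneg_left (ffc_norm_lsmChar_sub_one_le L j he) (abs_nonneg _)

/-- `(2 Σ_{e ∈ {0, ±e₁, ±e₂}} |d(e)/√2|)² = 32` for the `d_{x²-y²}` form factor (`d(±e₁) = 1`,
`d(±e₂) = -1`, `d(0) = 0`). [cite: Scalapino1995, §2] -/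
theorem ffc_dWave_normConstant_sq :
    (2 * ∑ e ∈ insert (0 : Site 2) unitSteps, |dWaveFormFactor e / Real.sqrt 2|) ^ 2 = 32 := by
  -- the finite sum, adapted from the refuter workfile Cruxes/WindowInfraredBound/Disproof.lean
  have hsum : ∑ e ∈ insert (0 : Site 2) unitSteps, |dWaveFormFactor e / Real.sqrt 2| =
      4 * (1 / Real.sqrt 2) := by
    have h1 : dWaveFormFactor (Pi.single 0 1) = 1 := if_pos (Or.inl rfl)
    have h2 : dWaveFormFactor (-Pi.single 0 1) = 1 := if_pos (Or.inr rfl)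
    have hne1 : ¬ ((Pi.single 1 1 : Site 2) = Pi.single 0 1 ∨
        (Pi.single 1 1 : Site 2) = -Pi.single 0 1) := by decide
    have hne2 : ¬ ((-Pi.single 1 1 : Site 2) = Pi.single 0 1 ∨
        (-Pi.single 1 1 : Site 2) = -Pi.single 0 1) := by decide
    have h3 : dWaveFormFactor (Pi.single 1 1) = -1 := by
      unfold dWaveFormFactor; rw [if_neg hne1, if_pos (Or.inl rfl)]
    have h4 : dWaveFormFactor (-Pi.single 1 1) = -1 := by
      unfold dWaveFormFactor; rw [if_neg hne2, if_pos (Or.inr rfl)]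
    have hs2 : (0 : ℝ) < Real.sqrt 2 := Real.sqrt_pos.2 two_pos
    have ha : |(1 : ℝ) / Real.sqrt 2| = 1 / Real.sqrt 2 := abs_of_pos (div_pos one_pos hs2)
    have hb : |(-1 : ℝ) / Real.sqrt 2| = 1 / Real.sqrt 2 := by rw [neg_div, abs_neg, ha]
    simp only [unitSteps]
    rw [Finset.sum_insert (by decide), Finset.sum_insert (by decide), Finset.sum_insert (by decide),
      Finset.sum_insert (by decide), Finset.sum_singleton, dWaveFormFactor_zero, h1, h2, h3, h4,
      zero_div, abs_zero, ha, hb]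
    ring
  rw [hsum, mul_pow, mul_pow, div_pow, one_pow, Real.sq_sqrt two_pos.le]
  norm_num

/-! ### The pair sum rule as a pigeonhole -/

/-- **The pair sum rule as a pigeonhole**: for every set `S` of momentum labels and every Fock
vector `ψ`, `Σ_{m ∈ S} S_ψ(m) ≤ 32 L² ‖ψ‖²` (`Σ_m S_ψ(m) = Σ_x ‖P_x ψ‖²`, `sum_pairStructureFactor`).
[cite: KLS1988PRL, p. 2582] -/
theorem ffc_sum_pairStructureFactor_le (S : Finset (TorusSite 2 L))
    (ψ : Fock (Orb (FermionTorus 2 L))) :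
    ∑ m ∈ S, pairStructureFactor dWaveFormFactor L ψ m ≤ 32 * (L : ℝ) ^ 2 * (star ψ ⬝ᵥ ψ).re := by
  -- local pair weight `‖P_x ψ‖² ≤ 32 ‖ψ‖²` (`‖P_x‖ ≤ 8/√2`)
  have hloc : ∀ x : TorusSite 2 L,
      (star (localPair dWaveFormFactor L x *ᵥ ψ) ⬝ᵥ (localPair dWaveFormFactor L x *ᵥ ψ)).re ≤
        32 * (star ψ ⬝ᵥ ψ).re := fun x => by
    refine (ffc_re_star_mulVec_dotProduct_mulVec_le_norm_sq _ ψ).trans ?_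
    refine mul_le_mul_of_nonneg_right ?_ (Complex.nonneg_iff.1 (dotProduct_star_self_nonneg _)).1
    rw [← ffc_dWave_normConstant_sq]
    exact pow_le_pow_left₀ (norm_nonneg _) (norm_localPair_le dWaveFormFactor L x) 2
  calc ∑ m ∈ S, pairStructureFactor dWaveFormFactor L ψ m
      ≤ ∑ m, pairStructureFactor dWaveFormFactor L ψ m :=
        Finset.sum_le_sum_of_subset_of_nonneg (Finset.subset_univ S)
          fun m _ _ => pairStructureFactor_nonneg _ _ _ _
    _ = ∑ x, (star (localPair dWaveFormFactor L x *ᵥ ψ) ⬝ᵥ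
          (localPair dWaveFormFactor L x *ᵥ ψ)).re := sum_pairStructureFactor _ _ ψ
    _ ≤ ∑ _x : TorusSite 2 L, 32 * (star ψ ⬝ᵥ ψ).re :=
        Finset.sum_le_sum fun x _ => hloc x
    _ = 32 * (L : ℝ) ^ 2 * (star ψ ⬝ᵥ ψ).re := by
        rw [Finset.sum_const, Finset.card_univ, card_torusSite_two L, nsmul_eq_mul]
        push_cast
        ring

/-! ### Averaging over the Lieb–Schultz–Mattis boosts -/

omit [NeZero L] in
/-- The doubled boost momenta `2k_j = (2j, 0)`, `2j < L`, are pairwise distinct. [folklore] -/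
theorem ffc_lsmMomentum_injOn (T : Finset ℕ) (hT : ∀ j ∈ T, 2 * j < L) :
    Set.InjOn (fun j : ℕ => (Pi.single 0 (j : ZMod L) : TorusSite 2 L) + Pi.single 0 (j : ZMod L))
      (T : Set ℕ) := by
  intro j hj j' hj' h
  have h0 := congrFun h 0
  simp only [Pi.add_apply, Pi.single_eq_same] at h0
  have h2 : ((2 * j : ℕ) : ZMod L) = ((2 * j' : ℕ) : ZMod L) := by push_cast; linear_combination h0
  have h3 := congrArg ZMod.val h2
  rwa [ZMod.val_natCast_of_lt (hT j hj), ZMod.val_natCast_of_lt (hT j' hj'),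
    Nat.mul_right_inj two_ne_zero] at h3

/-- **The `k = 0` pair order cannot survive all the Lieb–Schultz–Mattis boosts.** For every Fock
vector `ψ` on the torus of side `L` and every finite set `T` of windings `j` with `2j < L`,
`Σ_{j ∈ T} L⁻⁴ ‖Δ_d W_jᴴ ψ‖² ≤ (64 + 256 π² (Σ_{j ∈ T} j²) / L²) ‖ψ‖²`,
`W_j = orbitalPhase (x, σ) ↦ e^{2πi j x₁/L}` the boost by `k_j = (j, 0)`: each term is at most
`2 S_ψ(2k_j)/L² + 256 π² j²/L² ‖ψ‖²` (`ffc_twisted_pairOrder_le`, `ffc_lsmBoostConstant_le`,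
`(2·4/√2)² = 32`), the momenta `2k_j` are distinct, and `Σ_m S_ψ(m) ≤ 32 L² ‖ψ‖²`
(`ffc_sum_pairStructureFactor_le`). Hence among `J₀` windings some `j` has
`L⁻⁴ ‖Δ_d W_jᴴ ψ‖² ≤ 64/J₀ + 256 π² J₀²/L²` — the pigeonhole half of the route's necessary-pole
lemma (item stmt-HubbardSuperconductivity-7792). [cite: LiebSchultzMattisAP1961, Appendix B] -/
theorem ffc_sum_lsmBoosted_pairOrder_le (T : Finset ℕ) (hT : ∀ j ∈ T, 2 * j < L)
    (ψ : Fock (Orb (FermionTorus 2 L))) :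
    ∑ j ∈ T, (star ((orbitalPhase (fun i : Orb (FermionTorus 2 L) =>
          torusChar (Pi.single 0 (j : ZMod L) : TorusSite 2 L) (FermionTorus.toTorusSite (ofLex i).1)))ᴴ *ᵥ ψ) ⬝ᵥ
        ((1 / (L : ℂ) ^ 4) • ((pairField dWaveFormFactor L)ᴴ * pairField dWaveFormFactor L)) *ᵥ
          ((orbitalPhase (fun i : Orb (FermionTorus 2 L) =>
            torusChar (Pi.single 0 (j : ZMod L) : TorusSite 2 L)
              (FermionTorus.toTorusSite (ofLex i).1)))ᴴ *ᵥ ψ)).re ≤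
      (64 + 256 * Real.pi ^ 2 * (∑ j ∈ T, (j : ℝ) ^ 2) / (L : ℝ) ^ 2) * (star ψ ⬝ᵥ ψ).re := by
  have hL : (0 : ℝ) < L := Nat.cast_pos.2 (Nat.pos_of_ne_zero (NeZero.ne L))
  have hψ0 : 0 ≤ (star ψ ⬝ᵥ ψ).re := (Complex.nonneg_iff.1 (dotProduct_star_self_nonneg _)).1
  -- termwise bound
  have hterm : ∀ j ∈ T, (star ((orbitalPhase (fun i : Orb (FermionTorus 2 L) =>
          torusChar (Pi.single 0 (j : ZMod L) : TorusSite 2 L) (FermionTorus.toTorusSite (ofLex i).1)))ᴴ *ᵥ ψ) ⬝ᵥ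
        ((1 / (L : ℂ) ^ 4) • ((pairField dWaveFormFactor L)ᴴ * pairField dWaveFormFactor L)) *ᵥ
          ((orbitalPhase (fun i : Orb (FermionTorus 2 L) =>
            torusChar (Pi.single 0 (j : ZMod L) : TorusSite 2 L)
              (FermionTorus.toTorusSite (ofLex i).1)))ᴴ *ᵥ ψ)).re ≤
      2 * pairStructureFactor dWaveFormFactor L ψ
          ((Pi.single 0 (j : ZMod L) : TorusSite 2 L) + Pi.single 0 (j : ZMod L)) / (L : ℝ) ^ 2 +
        256 * Real.pi ^ 2 * (j : ℝ) ^ 2 / (L : ℝ) ^ 2 * (star ψ ⬝ᵥ ψ).re := by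
    intro j _
    refine (ffc_twisted_pairOrder_le L dWaveFormFactor _ ψ).trans (add_le_add le_rfl ?_)
    refine mul_le_mul_of_nonneg_right ?_ hψ0
    have hB := ffc_lsmBoostConstant_le L dWaveFormFactor j
    have hB0 : 0 ≤ 2 * ∑ e ∈ insert (0 : Site 2) unitSteps, |dWaveFormFactor e / Real.sqrt 2| *
        ‖torusChar (Pi.single 0 (j : ZMod L) : TorusSite 2 L) (Torus.proj L e) - 1‖ :=
      mul_nonneg zero_le_two (Finset.sum_nonneg fun e _ => by positivity)
    have hsq := pow_le_pow_left₀ hB0 hB 2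
    rw [mul_pow (2 * ∑ e ∈ insert (0 : Site 2) unitSteps, |dWaveFormFactor e / Real.sqrt 2|)
      (2 * Real.pi * j / L) 2, ffc_dWave_normConstant_sq] at hsq
    calc 2 * (2 * ∑ e ∈ insert (0 : Site 2) unitSteps, |dWaveFormFactor e / Real.sqrt 2| *
            ‖torusChar (Pi.single 0 (j : ZMod L) : TorusSite 2 L) (Torus.proj L e) - 1‖) ^ 2
        ≤ 2 * (32 * (2 * Real.pi * j / L) ^ 2) := by linarith
      _ = 256 * Real.pi ^ 2 * (j : ℝ) ^ 2 / (L : ℝ) ^ 2 := by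
          field_simp
          ring
  refine (Finset.sum_le_sum hterm).trans ?_
  rw [Finset.sum_add_distrib, ← Finset.sum_div, ← Finset.mul_sum, ← Finset.sum_mul]
  -- the structure-factor sum over the distinct momenta `2k_j`
  have hS : ∑ j ∈ T, pairStructureFactor dWaveFormFactor L ψ
      ((Pi.single 0 (j : ZMod L) : TorusSite 2 L) + Pi.single 0 (j : ZMod L)) ≤
      32 * (L : ℝ) ^ 2 * (star ψ ⬝ᵥ ψ).re := by
    rw [← Finset.sum_image (ffc_lsmMomentum_injOn L T hT)]
    exact ffc_sum_pairStructureFactor_le L _ ψ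
  have h1 : 2 * (∑ j ∈ T, pairStructureFactor dWaveFormFactor L ψ
      ((Pi.single 0 (j : ZMod L) : TorusSite 2 L) + Pi.single 0 (j : ZMod L))) / (L : ℝ) ^ 2 ≤
      64 * (star ψ ⬝ᵥ ψ).re := by
    rw [div_le_iff₀ (by positivity)]
    nlinarith
  have h2 : ∑ j ∈ T, 256 * Real.pi ^ 2 * (j : ℝ) ^ 2 / (L : ℝ) ^ 2 =
      256 * Real.pi ^ 2 * (∑ j ∈ T, (j : ℝ) ^ 2) / (L : ℝ) ^ 2 := by
    rw [Finset.mul_sum, Finset.sum_div]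
  rw [h2]
  nlinarith

end LsmBoosts

/-! ### The necessary-pole lemma, twist form -/

/-- `Σ_{j=1}^{J} j² ≤ J³` (real form). [folklore] -/
theorem ffc_sum_Icc_sq_le (J : ℕ) : ∑ j ∈ Finset.Icc 1 J, ((j : ℕ) : ℝ) ^ 2 ≤ (J : ℝ) ^ 3 := by
  calc ∑ j ∈ Finset.Icc 1 J, ((j : ℕ) : ℝ) ^ 2 ≤ ∑ _j ∈ Finset.Icc 1 J, (J : ℝ) ^ 2 :=
        Finset.sum_le_sum fun j hj => by
          have := (Finset.mem_Icc.1 hj).2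
          gcongr
    _ = (J : ℝ) ^ 3 := by
        rw [Finset.sum_const, Nat.card_Icc, nsmul_eq_mul]
        push_cast
        ring

/-- **The necessary-pole lemma, twist form** (item stmt-HubbardSuperconductivity-7792 as the
typing `NecessaryPoleOrderTwistForm` proposed by this seat). For every function-field certificate
`c : SymbolCertificate U δ deg p a` of `d`-wave pair order `a > 0` at a doping `δ ∈ (0, 1/2)` there
is a side `L₁` such that on every even torus of side `L ≥ L₁`, for EVERY normalised
`(N_L, S^z = 0)`-sector ground state `ψ` of `hubbardTorus 2 L 1 U`, some Lieb–Schultz–Mattis boost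
`W_j = orbitalPhase ((x,σ) ↦ χ_{(j,0)}(x))` with `1 ≤ j ≤ ⌊256/a⌋ + 1` has
`a/4 < |Σ_{(Q,w) ∈ kkt} Σ_κ Re w(κ) · Re ⟨W Q(κ) Wᴴ ψ, [D, W Q(κ) Wᴴ] ψ⟩ + Re ⟨ψ, [D, W R_L Wᴴ] ψ⟩|`,
`D = W H_L Wᴴ - H_L`: the certificate's KKT/`R` channels cannot all have small twist defects.
[folklore] -/
theorem necessaryPoleOrder_twistForm :
    ∀ (U δ a : ℚ) (deg p : ℕ), 0 < a → (δ : ℝ) ∈ Set.Ioo (0 : ℝ) (1 / 2) →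
    ∀ c : SymbolCertificate U δ deg p a, ∃ L₁ : ℕ, ∀ (L : ℕ) [NeZero L], L₁ ≤ L → Even L →
      ∀ ψ : Fock (Orb (FermionTorus 2 L)), star ψ ⬝ᵥ ψ = 1 →
        IsGroundStateInSector (hubbardTorus 2 L 1 (U : ℝ))
          (2 * ⌊(1 - (δ : ℝ)) * (L : ℝ) ^ 2 / 2⌋₊) 0 ψ →
        ∃ j : ℕ, 1 ≤ j ∧ j ≤ ⌊(256 : ℝ) / a⌋₊ + 1 ∧
          let W : Matrix (Finset (Orb (FermionTorus 2 L))) (Finset (Orb (FermionTorus 2 L))) ℂ :=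
            orbitalPhase fun i : Orb (FermionTorus 2 L) =>
              torusChar (Pi.single 0 (j : ZMod L)) (FermionTorus.toTorusSite (ofLex i).1)
          let D : Matrix (Finset (Orb (FermionTorus 2 L))) (Finset (Orb (FermionTorus 2 L))) ℂ :=
            W * hubbardTorus 2 L 1 (U : ℝ) * Wᴴ - hubbardTorus 2 L 1 (U : ℝ)
          (a : ℝ) / 4 <
            |(c.kkt.map fun F => ∑ κ : Fin F.arity → TorusSite 2 L, (F.weight.eval L κ).re *
                (star ((W * F.op.eval (hubbardMomentumModel U δ) L κ * Wᴴ) *ᵥ ψ) ⬝ᵥ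
                  (D * (W * F.op.eval (hubbardMomentumModel U δ) L κ * Wᴴ) -
                    (W * F.op.eval (hubbardMomentumModel U δ) L κ * Wᴴ) * D) *ᵥ ψ).re).sum +
              (star ψ ⬝ᵥ (D * (W * weightedSum (hubbardMomentumModel U δ) c.rch L * Wᴴ) -
                (W * weightedSum (hubbardMomentumModel U δ) c.rch L * Wᴴ) * D) *ᵥ ψ).re| := by
  intro U δ a deg p ha hδ c
  classical
  -- `J₀ = ⌊256/a⌋ + 1 > 256/a`
  set J₀ : ℕ := ⌊(256 : ℝ) / a⌋₊ + 1 with hJ₀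
  have ha' : (0 : ℝ) < a := by exact_mod_cast ha
  have hJ₀a : (256 : ℝ) < J₀ * a := by
    have h := Nat.lt_floor_add_one ((256 : ℝ) / a)
    rw [div_lt_iff₀ ha'] at h
    rw [hJ₀]
    push_cast
    exact h
  have hJ₀pos : (1 : ℝ) ≤ J₀ := by
    rw [hJ₀]; push_cast; linarith [Nat.cast_nonneg (α := ℝ) ⌊(256 : ℝ) / a⌋₊]
  -- the threshold side
  refine ⟨c.L₀ + (2 * J₀ + 1) + ⌈8 * |c.C| / (a : ℝ)⌉₊ + ⌈16 * Real.pi * (J₀ : ℝ) ^ 2⌉₊,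
    fun L _ hL hEven ψ hψ1 hgs => ?_⟩
  by_contra hcon
  push Not at hcon
  set T : Finset ℕ := Finset.Icc 1 J₀ with hT
  have hL0 : c.L₀ ≤ L := by omega
  have hTJ : ∀ j ∈ T, 2 * j < L := fun j hj => by
    have h1 := (Finset.mem_Icc.1 hj).2
    omega
  have hLpos : (0 : ℝ) < L := Nat.cast_pos.2 (Nat.pos_of_ne_zero (NeZero.ne L))
  have hceil1 : ⌈8 * |c.C| / (a : ℝ)⌉₊ ≤ L := by omega
  have hceil2 : ⌈16 * Real.pi * (J₀ : ℝ) ^ 2⌉₊ ≤ L := by omega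
  have hLC : 8 * |c.C| / (a : ℝ) ≤ (L : ℝ) :=
    (Nat.le_ceil _).trans (by exact_mod_cast hceil1)
  have hLJ : 16 * Real.pi * (J₀ : ℝ) ^ 2 ≤ (L : ℝ) :=
    (Nat.le_ceil _).trans (by exact_mod_cast hceil2)
  -- lower bound on each boosted pair order, from the certificate and the absurd hypothesis
  have hlow : ∀ j ∈ T, 5 * (a : ℝ) / 8 ≤
      (star ((orbitalPhase (fun i : Orb (FermionTorus 2 L) =>
          torusChar (Pi.single 0 (j : ZMod L) : TorusSite 2 L) (FermionTorus.toTorusSite (ofLex i).1)))ᴴ *ᵥ ψ) ⬝ᵥ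
        ((1 / (L : ℂ) ^ 4) • ((pairField dWaveFormFactor L)ᴴ * pairField dWaveFormFactor L)) *ᵥ
          ((orbitalPhase (fun i : Orb (FermionTorus 2 L) =>
            torusChar (Pi.single 0 (j : ZMod L) : TorusSite 2 L)
              (FermionTorus.toTorusSite (ofLex i).1)))ᴴ *ᵥ ψ)).re := by
    intro j hj
    have hj' := Finset.mem_Icc.1 hj
    have hg' : ∀ i : Orb (FermionTorus 2 L), ‖star (torusChar (Pi.single 0 (j : ZMod L) : TorusSite 2 L)
        (FermionTorus.toTorusSite (ofLex i).1))‖ = 1 := fun i => by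
      rw [norm_star]; exact ffc_norm_boostPhase L _ i
    have hWg : orbitalPhase (fun i : Orb (FermionTorus 2 L) => star (torusChar
          (Pi.single 0 (j : ZMod L) : TorusSite 2 L) (FermionTorus.toTorusSite (ofLex i).1))) =
        (orbitalPhase (fun i : Orb (FermionTorus 2 L) =>
          torusChar (Pi.single 0 (j : ZMod L) : TorusSite 2 L) (FermionTorus.toTorusSite (ofLex i).1)))ᴴ :=
      (conjTranspose_orbitalPhase _).symm
    have h2 := hubbardSymbolCertificate_twisted_order_expectation_ge c L hL0 hEven hg'
      (D := orbitalPhase (fun i : Orb (FermionTorus 2 L) =>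
            torusChar (Pi.single 0 (j : ZMod L) : TorusSite 2 L) (FermionTorus.toTorusSite (ofLex i).1)) *
          hubbardTorus 2 L 1 (U : ℝ) *
          (orbitalPhase (fun i : Orb (FermionTorus 2 L) =>
            torusChar (Pi.single 0 (j : ZMod L) : TorusSite 2 L) (FermionTorus.toTorusSite (ofLex i).1)))ᴴ -
          hubbardTorus 2 L 1 (U : ℝ))
      (by rw [hWg, conjTranspose_conjTranspose, add_sub_cancel]) hψ1 hgs
    rw [hWg, conjTranspose_conjTranspose] at h2
    have hdef := hcon j hj'.1 hj'.2
    simp only [not_lt] at hdef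
    have hdef' := (abs_le.1 hdef).1
    have hC : -((a : ℝ) / 8) ≤ -(c.C / L) := by
      have h1 : c.C / L ≤ |c.C| / L := div_le_div_of_nonneg_right (le_abs_self _) hLpos.le
      have h3 : |c.C| / L ≤ (a : ℝ) / 8 := by
        rw [div_le_iff₀ hLpos]
        have := (div_le_iff₀ ha').1 hLC
        linarith
      linarith
    linarith
  -- upper bound on their sum, from the pair sum rule
  have hup := ffc_sum_lsmBoosted_pairOrder_le L T hTJ ψ
  rw [hψ1, Complex.one_re, mul_one] at hup
  have hsumsq : 256 * Real.pi ^ 2 * (∑ j ∈ T, (j : ℝ) ^ 2) / (L : ℝ) ^ 2 ≤ 1 := by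
    rw [div_le_one (by positivity)]
    have h1 : ∑ j ∈ T, ((j : ℕ) : ℝ) ^ 2 ≤ (J₀ : ℝ) ^ 3 := ffc_sum_Icc_sq_le J₀
    have h2 : (16 * Real.pi * (J₀ : ℝ) ^ 2) ^ 2 ≤ (L : ℝ) ^ 2 :=
      pow_le_pow_left₀ (by positivity) hLJ 2
    have h3 : (J₀ : ℝ) ^ 3 ≤ (J₀ : ℝ) ^ 4 := by
      calc (J₀ : ℝ) ^ 3 = (J₀ : ℝ) ^ 3 * 1 := (mul_one _).symm
        _ ≤ (J₀ : ℝ) ^ 3 * J₀ := mul_le_mul_of_nonneg_left hJ₀pos (by positivity)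
        _ = (J₀ : ℝ) ^ 4 := by ring
    have hπ : 0 ≤ Real.pi ^ 2 := sq_nonneg _
    nlinarith
  -- count: `J₀ · 5a/8 ≤ Σ_T ≤ 65`, but `J₀ a > 256`
  have hcard : (T.card : ℝ) = J₀ := by rw [hT, Nat.card_Icc]; push_cast; ring
  have hsum_low := Finset.card_nsmul_le_sum T _ _ hlow
  rw [nsmul_eq_mul, hcard] at hsum_low
  linarith

end Summit.HubbardSuperconductivity.HubbardSuperconductivity.Theorems
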